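import Literature.NumberTheory.Transcendental.AnalytificationFunctorialityProofs
import HarnessLib

/-!
# Uniqueness of the analytification (proof file)

Sibling proof file of `Literature/NumberTheory/Transcendental/Analytification.lean`, which vendors
as a *named fact* `Literature.NumberTheory.Transcendental.IsAnalytification.unique`: two
analytifications `φ : M → X(ℂ)`, `ψ : M' → X(ℂ)` of the same smooth `k`-scheme `X` (`k ⊆ ℂ`),
both carrying holomorphic atlases, differ by a biholomorphism `h : M ≃ₜ M'` over `X(ℂ)`
(`ψ ∘ h = φ`). This file proves it: `IsAnalytification.unique_holds`.

The printed source is Serre, GAGA §2 n°5, Prop. 2 (p. 8): «Il existe sur `X` une structure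
d'espace analytique et une seule telle que, pour toute carte `φ : V → U`, l'ensemble Z-ouvert `V`
soit ouvert, et `φ` soit un isomorphisme analytique de `V` … sur `U`», whose uniqueness half
(«L'unicité est évidente, puisque l'on peut recouvrir `X` par des ensembles Z-ouverts `V`
possédant des cartes») is, in the tree's formulation by a universal map `φ : M → X(ℂ)`, the
statement that the comparison homeomorphism `h = ψ⁻¹ ∘ φ` is holomorphic in both directions.

## Proof

This is the special case `g = 𝟙 X` of the functoriality of the analytification («si
`f : X → Y` est une application régulière …, `f` est aussi une application holomorphe de `X^h`
dans `Y^h`», GAGA §2 n°5 p. 9), proved in the tree as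
`IsAnalytification.mdifferentiable_comp_map_holds` (file `AnalytificationFunctorialityProofs`,
via the Clements–Osgood theorem): `h = ψ⁻¹ ∘ 𝟙(ℂ) ∘ φ` is holomorphic `M → M'`, and
symmetrically `h⁻¹ = φ⁻¹ ∘ 𝟙(ℂ) ∘ ψ` is holomorphic `M' → M`. The homeomorphism `h` is
`hφ.homeomorph.trans hψ.homeomorph.symm`.

## References

* J.-P. Serre, *Géométrie algébrique et géométrie analytique*, Ann. Inst. Fourier 6 (1956),
  §2 n°5, Prop. 2 (p. 8) and p. 9.
* A. Grothendieck, M. Raynaud, *SGA 1*, Exp. XII, Thm. 1.1.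
-/

noncomputable section

open scoped Manifold ContDiff
open CategoryTheory

namespace Literature.NumberTheory.Transcendental

namespace IsAnalytification

variable {E : Type*} [NormedAddCommGroup E] [NormedSpace ℂ E] [FiniteDimensional ℂ E]
  {E' : Type*} [NormedAddCommGroup E'] [NormedSpace ℂ E'] [FiniteDimensional ℂ E']
  {M : Type*} [TopologicalSpace M] [ChartedSpace E M]
  {M' : Type*} [TopologicalSpace M'] [ChartedSpace E' M']
  {k : Type} [Field k] [Algebra k ℂ] {X : Literature.AlgebraicGeometry.Motives.SchemeOver k} {d : ℕ}
  {φ : M → Literature.AlgebraicGeometry.Motives.ComplexPoints X}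

/-- **Uniqueness of the analytification** (Serre, GAGA §2 n°5, Prop. 2, p. 8: «Il existe sur `X`
une structure d'espace analytique et une seule telle que … toute carte algébrique [soit] une
carte analytique»; SGA 1 XII Thm. 1.1): the named fact
`Literature.NumberTheory.Transcendental.IsAnalytification.unique` holds. Two analytifications
`φ : M → X(ℂ)`, `ψ : M' → X(ℂ)` of a smooth `k`-scheme `X`, locally of finite type, with
holomorphic atlases on `M`, `M'`, differ by the biholomorphism
`h = ψ⁻¹ ∘ φ = hφ.homeomorph.trans hψ.homeomorph.symm : M ≃ₜ M'`, `ψ ∘ h = φ`. Proof: both `h`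
and `h⁻¹` are instances of the functoriality `mdifferentiable_comp_map_holds` with `g = 𝟙 X`
(GAGA §2 n°5 p. 9). [cite: SerreGAGA1956, §2 n°5 Prop. 2 (p. 8, unicité de X^h) and p. 9] -/
theorem unique_holds :
    IsAnalytification.unique (E := E) (E' := E') (M := M) (M' := M') (X := X) (d := d) (φ := φ) := by
  intro _ _ _ _ ψ hφ hψ
  have hsymm : ∀ y, ψ (hψ.homeomorph.symm y) = y := fun y ↦ hψ.homeomorph.apply_symm_apply y
  have hsymm' : ∀ y, φ (hφ.homeomorph.symm y) = y := fun y ↦ hφ.homeomorph.apply_symm_apply y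
  refine ⟨hφ.homeomorph.trans hψ.homeomorph.symm, ?_, ?_, ?_⟩
  · refine mdifferentiable_comp_map_holds hφ hψ (𝟙 X) _ ?_
    funext m
    simp only [Function.comp_apply, Homeomorph.trans_apply, coe_homeomorph, hsymm,
      Literature.AlgebraicGeometry.Motives.AlgPoints.map_id_apply]
  · refine mdifferentiable_comp_map_holds hψ hφ (𝟙 X) _ ?_
    funext m'
    simp only [Function.comp_apply, Homeomorph.symm_trans_apply, Homeomorph.symm_symm,
      coe_homeomorph, hsymm', Literature.AlgebraicGeometry.Motives.AlgPoints.map_id_apply]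
  · funext m
    simp only [Function.comp_apply, Homeomorph.trans_apply, coe_homeomorph, hsymm]

end IsAnalytification

end Literature.NumberTheory.Transcendental
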